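import Summits.BirchSwinnertonDyer.Rank1Residual.O5.HeegnerLogTransportThreeCitedEnd
import Summits.BirchSwinnertonDyer.Rank1Residual.O5.HeegnerLogTransportStepZero
import Summits.BirchSwinnertonDyer.Rank1Residual.O5.HeegnerLogTransportThreeShaDescent
import Summits.BirchSwinnertonDyer.Rank1Residual.AdditivePotMult.RankOneHeegnerAnyPrime
import Literature.NumberTheory.QuadraticFields.ImaginaryResiduePiForm
import Summits.BirchSwinnertonDyer.Rank1Residual.X2.TwistTamagawa
import Literature.NumberTheory.EllipticCurves.ModularityVersionApProofs
import HarnessLib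
import HarnessLib.Audit.Tags

/-!
# O5 (t′) — KL3 part 18: the END of record with STEP-0 DISCHARGED (o5-r2 GEN 22; §4 o5-r2 GEN 23)

Research route (cell `b2b-bsdres`, class O5 = tame potentially-supersingular additive `p = 3` (t′), `9 ‖ N`);
**honest framing**: a CONDITIONAL theorem whose displayed inputs are published theorems vendored as named
facts + per-pair binders; nothing booked, no mark / label / count / tier of `RESIDUAL-MAP.md` moves,
census = EVIDENCE (never a Literature fact); O5 stays OPEN as a class. THEOREMS ONLY — 0 `def`,
0 `@[conjecture]`, 0 Literature facts, no `sorry`.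

## What changes relative to parts 9 / 15 (o5-r2 GEN 21)

The ENDs `o5_index_unit_of_ordinary_companion_facts` (part 9, modulo the typed node KL3-A) and
`o5_index_unit_of_ordinary_companion_cited` (part 15, KL3-A := Kriz–Li 2019 Thm. 1.16 cited) carry
STEP-0 — Gross–Zagier at the companion pair `(G, G_d = G^{(d_K)})` in BSD currency, `3`-adically — as the
binders `{q₀ q₁ : ℚ} (hq₀ : shaAn G = q₀) (hq₁ : shaAn Gd = q₁) (hstep0 : ord₃ q₀ + ord₃ q₁ + 2 ord₃ ∏c(G)
+ 2 ord₃ c_{D′} = 2 ord₃ [G(K) : ℤP′])`, i.e. as a per-row NUMERICAL input no computation certifies.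
Part 17 (`HeegnerLogTransportStepZero`) proves STEP-0 from the tree's exact Gross–Zagier bookkeeping
(`X11b.exists_shaAn_padicVal_eq_of_heegner`, `AdditivePotMult.exists_shaAn_padicVal_eq_of_heegner_rankZero`),
and the rationality of `#Ш_an(G)`, `#Ш_an(G_d)` is Yan–Zhu 2026 Thm. 4.15 on row C16 (`hYZ`; both members
good ordinary at `3`, `ρ̄` irreducible: `RowC16.bsdp` ⇒ Miller's `BSD(·,3)`). So the five STEP-0 binders
DISAPPEAR. What replaces them is elementary and decidable per row:

* `h3K : SatisfiesHeegnerHypothesis 3 K` — `3` splits in `K` (the census chooses `K` so; it implies the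
  old binder `3 ∤ d_K`, and gives `ord₃ u = 0` for the minimal model of the twist,
  `AdditivePotMult.padicValRat_u_eq_zero_of_twist_minimal_of_split`);
* `hc3' : ¬ 3 ∣ c(D′)` — the Manin constant of the companion's parametrisation is prime to `3`
  (replaces `hcD′ : ord₃ c(D′) = 0`, which it implies; `c = ±1` for an optimal curve without `3`-isogeny);
* `htamGd : 3 ∤ ∏_ℓ c_ℓ(G_d)` — Tamagawa product of the minimal twist (Tate's algorithm; in print it equals
  `ord₃ ∏_ℓ c_ℓ(G) = 0` since every `q ∣ N′` splits in `K` and `c_ℓ(G_d) ∣ 4` at `ℓ ∣ d_K`; §4 proves this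
  symmetry for odd `d_K` from the cell's X2 transport and keeps the datum displayed only for even `d_K`;
  likewise §4 proves `h3K` from `hH`, `hadd`, `hmod`);

and `w_K = 2` (`d_K < -4`, tree theorem `Quadratic.torsionOrder_eq_two_of_discr_lt_neg_four`) supplies
`3 ∤ #𝓞_K^×` internally.

## Contents

* §1 `o5_index_unit_of_ordinary_companion_facts_s0` — part 9's END (modulo KL3-A `hA`), STEP-0 discharged.
* §2 `o5_index_unit_of_ordinary_companion_cited_s0` — part 15's END (KL3-A := Kriz–Li Thm. 1.16 cited,
  `hKL`), STEP-0 discharged. THIS is the END of record of o5-r2 GEN 22.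
* §3 `o5_index_unit_of_ordinary_companion_cited_s0d` — §2 with `hshaW : #Ш(W/K)[3^∞] = 1` discharged by
  what the census computes: two sharp `3`-descents over `ℚ` (`#Sel^(3)(W/ℚ) = 3^{rank W(ℚ)}`,
  `#Sel^(3)(W_t/ℚ) = 3^{rank W_t(ℚ)}` for a model `W_t` of `W^{(d_K)}`) and `3 ∤ #W_t(ℚ)_tors`
  (part 19, `HeegnerLogTransportThreeShaDescent`: PROVED fundamental sequence + quadratic base change of
  `Ш[p^∞]`, Jetchev–Skinner–Wan §7.4.1). The certificate form of the END of record.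
* §4 (o5-r2 GEN 23) `o5_index_unit_of_ordinary_companion_cited_s0e` — §3 with the two residual
  non-certificate binders discharged by END-author glue over tree theorems: `h3K` DELETED
  (`satisfiesHeegnerHypothesis_three_of_addv`: `hH` + Carayol `N = N_W` from `hmod` + `3 ∣ N_W` from
  `hadd`) and `htamGd` WEAKENED to `htamGd' : Even d_K → 3 ∤ ∏c(G_d)` (for odd `d_K` proved from `htamG`
  by the cell's X2 transport, `not_three_dvd_tamagawaProduct_twist_of_heegner`). THIS is the END of
  record of o5-r2 GEN 23.

Displayed per-row inputs of the END of record after this file (W = the (t′) curve of conductor `N`, G = a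
`3`-congruent good-ordinary companion of conductor `N′`, `K` Heegner for `N` and `N′` with `d_K < -4` and
`3` split): the congruence `hcong` (Sturm-bound certificate), `hρ` (surjective mod `3`), `hadd`, `ht3`/`htℓ`
(no local `3`-torsion at `3` and at `ℓ ∣ N N′`; dischargeable by `3 ∤ c_ℓ · #W̃_ns(𝔽_ℓ)`, harvest-2's
`GoodReductionLocalThreeTorsion`), `hunitW`/`hunitG` (Kriz–Li Euler factors off `3`), `htam`/`htamG`/`htamGd`,
`hordG`, the Heegner points `P`, `P′` of the data `D`, `D′` non-torsion, `hshaW : #Ш(W/K)[3^∞] = 1` (§2;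
in §3: the two `3`-descent counts + the twist's torsion), `hQW`
(a non-torsion `Q ∈ W(K)` with unit-normalised `3`-adic logarithm at `𝔭`: census column `dE = 0`, part 12),
`hcD` (`ord₃ c(D) = 0`) and `hc3'` (`3 ∤ c(D′)`). On the companion side NOTHING analytic is displayed.

[cite: KrizLi2019, Thm. 1.16, Rem. 1.17] [cite: YanZhu2024MainConjNonCM, Thm. 4.15 (§4.6) = Cor. 1.4]
[cite: GrossZagier1986, Thm. I.6.3 with V.§2 (pp. 310–312)] [cite: Miller2011LMS, Def. 1.1]
[cite: Oesterle1988Gauss, II §1 p. 53] [cite: SilvermanAEC2009, VII.1 Prop. 1.3(b), X.4 Thm. 4.2(a) and X.5 Cor. 5.4]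
[cite: JetchevSkinnerWan2017, §7.4.1 (arXiv:1512.06894 p. 30)]

## TYPER PLACEMENT NOTE (cc-typer-5 GEN 19 = O5 §3.5 / O6 §3.4 typer of record; by-name ask A-O5-G23-1 of o5-r2 GEN 23, HOME/INBOX.md l.14299 (1)
+ l.14331 / l.14351 / close l.14380: 'part 18 := v2 b117be44ce0dd2b4, AFTER parts 15 + 19; v1 2a106af2d8c83d2e SUPERSEDED (never placed)'; order of record 15 -> 18)

Source: `HOME/b2b-bsdres-o5-r2/gen23/lean/HeegnerLogTransportThreeStepZeroEnd.lean` sha16 `b117be44ce0dd2b4` (433 l.; `gen23/SHA16.txt`; o5-r2's checks: merged scratch on TREE imports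
`gen23/lean/scratch/scratch_p15_17_19_18v2.lean` 3dbe6fb4831d1df0 rc 0 / 0 err / 0 warn / 0 sorry (snapshot + `--no-snap`), `#print axioms
o5_index_unit_of_ordinary_companion_cited_s0e` = {propext, Classical.choice, Quot.sound}), re-hashed by the typer right before writing.  SPLIT (typer; the source's
433 lines exceed the gate's 400-line `lint.size` for new files — the one-file placement 1f907df27da0333a dry-ran BOUNCED `lint.size` 454): KL3 part 18 = TWO files,
every declaration block byte-identical and in source order (script `class-closure/typer-5/gen19/g23_split.py`, anchors asserted):
  THIS file (file 1) = source l.1–302 (imports, module text, §0–§3 = `not_three_dvd_discr_of_split`, `not_three_dvd_unitsTorsionOrder_of_discr_lt`,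
  `o5_index_unit_of_ordinary_companion_facts_s0`, `…_cited_s0`, `…_cited_s0d`) + the closing `end`s (l.431–433) + this paragraph; the module text above is the
  source's UNCHANGED, so its '§4' bullet describes the SIBLING file 2 `O5/HeegnerLogTransportThreeStepZeroEndRecord.lean` (= source §4 l.304–430 verbatim:
  `three_dvd_conductorNorm_of_addv`, `satisfiesHeegnerHypothesis_three_of_addv`, `not_three_dvd_tamagawaProduct_twist_of_heegner`, END of record `…_cited_s0e`).
Placed AFTER part 15 `O5/HeegnerLogTransportThreeCitedEnd.lean` (p353868, this seat), part 17 `O5/HeegnerLogTransportStepZero.lean` (p352755) and part 19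
`O5/HeegnerLogTransportThreeShaDescent.lean` (p352972); the typer's standalone farm check of the unsplit file (rc 0 / 0 warnings, axioms of `_cited_s0e` std) and of each
split file, and DEDUP (`lean search --decl` on the 9 new names: no match) precede the proposals.
CONTENT LABELS (source, unchanged): THEOREMS ONLY — 0 `def`, 0 `@[conjecture]`, 0 Literature facts (net named-fact debt 0), no `sorry`; published inputs stay displayed
hypotheses BY NAME (Kriz–Li Thm. 1.16 as the registered Literature fact A314 `KrizLi2019.thm116_padicLogHeegner_congruence`, Yan–Zhu, Kolyvagin, Gross–Zagier(–Kolyvagin),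
modularity `exists_isNewformOf`, …); tree inputs reused BY NAME (part 17 `stepZero_three_of_heegner_pair`, part 19 `hshaW_of_threeDescent_of_surjective`, …), nothing re-proved.
KL3 parts in the tree: 1–3 p340741 / p341262 / p341640 (part 1 doc restamp p353140), Global p342632, OrdCompanion p343587 + p344465, OrdSelmer p345030 + p345686,
OrdTwist p346273, Residual Engine p347366 + Residual p348865 + End p350277, BaseSelmer p349318, ExactCount p349954, GoodSelmer p350559, TameTamagawa p350983,
RatLogUnit p351404, ResidualEndFacts p352109, BaseSelmerCount p352220, KrizLiGlue p352538, StepZero p352755, ShaDescent p352972, CitedEnd p353868; Literature index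
lemma p344022, A314 p350088.  HONEST FRAMING (cell `b2b-bsdres`): research route, lane CLASS-CLOSURE §3.5 O5; CONDITIONAL theorems — nothing asserted beyond the
displayed binders, nothing booked, no mark of `RESIDUAL-MAP.md` moves; census = EVIDENCE, never a Literature fact; O5 OPEN.
-/

noncomputable section

open scoped Classical

open WeierstrassCurve Literature.NumberTheory.EllipticCurves
  Literature.NumberTheory.EllipticCurves.ModularForms
  Literature.NumberTheory.EllipticCurves.Rank1Residual
  Literature.NumberTheory.EllipticCurves.Rank1Residual.Typed
open Summit.BirchSwinnertonDyer.Rank1Residual.X11b (embAt)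
open IsDedekindDomain (HeightOneSpectrum)
open Literature.NumberTheory.GaloisCohomology (poitouTate_selmerStructure_duality)
open Literature.NumberTheory.GaloisRepresentations (localEulerPoincareCharacteristic)
open scoped NumberField

namespace Summit.BirchSwinnertonDyer.Rank1Residual.O5.HeegnerLogTransport

/-! ## §0 The three elementary consequences of the new binders -/

/-- `3` split in `K` ⇒ `3 ∤ d_K`. [folklore] -/
theorem not_three_dvd_discr_of_split (K : Type) [Field K] [NumberField K] (hK : IsImaginaryQuadratic K)
    (h3K : SatisfiesHeegnerHypothesis 3 K) : ¬ ((3 : ℤ) ∣ NumberField.discr K) := by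
  have := Literature.SatisfiesHeegnerHypothesis.not_dvd_discr hK.1 h3K Nat.prime_three (dvd_refl 3)
  exact_mod_cast this

/-- `d_K < -4` ⇒ `3 ∤ w_K = #𝓞_K^× = 2`. [cite: Oesterle1988Gauss, II §1 p. 53] -/
theorem not_three_dvd_unitsTorsionOrder_of_discr_lt (K : Type) [Field K] [NumberField K]
    (hK : IsImaginaryQuadratic K) (hd : NumberField.discr K < -4) :
    ¬ 3 ∣ NumberField.Units.torsionOrder K := by
  rw [Literature.NumberTheory.QuadraticFields.Quadratic.torsionOrder_eq_two_of_discr_lt_neg_four hK.1 hd]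
  decide

/-! ## §1 Part 9's END (modulo KL3-A) with STEP-0 discharged -/

/-- **O5 (t′) END modulo KL3-A, STEP-0 discharged.** Part 9's `o5_index_unit_of_ordinary_companion_facts`
with the STEP-0 binders `{q₀ q₁} hq₀ hq₁ hstep0` PROVED: `q₀ = #Ш_an(G)`, `q₁ = #Ш_an(G_d)` exist by
Yan–Zhu 2026 Thm. 4.15 on row C16 (`hYZ`, `RowC16.bsdp`, Miller's `BSD(·,3)`; the row-C16 membership of
the pair and its analytic ranks `≤ 1` are the class-level discharges of o5-r2 GEN 19), and the valuation
identity is part 17's `stepZero_three_of_heegner_pair` (Gross–Zagier bookkeeping, exact at `p = 3`), fed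
with `ord₃ u = 0` (`3` split in `K`), `w_K = 2` (`d_K < -4`) and the displayed `3 ∤ c(D′)`, `3 ∤ ∏c(G)`,
`3 ∤ ∏c(G_d)`. New binders: `h3K` (replaces `h3d`), `hc3'` (replaces `hcD′`), `htamGd`. Conclusion:
`3 ∤ [W(K) : ℤP]`. [cite: YanZhu2024MainConjNonCM, Thm. 4.15 (§4.6) = Cor. 1.4]
[cite: GrossZagier1986, Thm. I.6.3 with V.§2 (pp. 310–312)] [cite: Miller2011LMS, Def. 1.1 (arXiv:1010.2431 p. 3)]
[cite: KrizLi2019, Thm. 1.16, Rem. 1.17] [cite: SilvermanAEC2009, VII.1 Prop. 1.3(b) and X.5 Cor. 5.4] -/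
theorem o5_index_unit_of_ordinary_companion_facts_s0
    (hA : KrizLiUnitBitTransportThree)
    (hPT : ∀ (K : Type) [Field K] [NumberField K], poitouTate_selmerStructure_duality K)
    (hEP : ∀ (K : Type) [Field K] [NumberField K] (v : HeightOneSpectrum (𝓞 K)),
      localEulerPoincareCharacteristic (v.adicCompletion K))
    (hYZ : YanZhu2026.thm415_padicValRat_bsd_rank_le_one)
    (hW20 : Wuthrich2014.lemma20_surjective_threeAdic_of_semistable)
    (hmod : exists_isNewformOf) (hGZK : rank_eq_analyticRank_of_analyticRank_le_one)
    (W G : WeierstrassCurve ℚ) [W.IsElliptic] [W.IsGloballyMinimal] [G.IsElliptic] [G.IsGloballyMinimal]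
    (hcong : ∀ ℓ : ℕ, ℓ.Prime → ¬ (ℓ ∣ 3 * W.conductorNorm ℤ * G.conductorNorm ℤ) →
      ((W.LFunction ℓ : ℤ) : ZMod 3) = ((G.LFunction ℓ : ℤ) : ZMod 3))
    (hρ : W.HasSurjectiveModNGaloisRep 3) (hadd : Addv W 3) (ht3 : NoLocalThreeTorsionAt W 3)
    (htℓ : ∀ (ℓ : ℕ) [Fact ℓ.Prime], ℓ ≠ 3 → (ℓ : ℤ) ∣ W.conductorNorm ℤ * G.conductorNorm ℤ →
      NoLocalThreeTorsionAt W ℓ)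
    (hunitW : ∀ ℓ ∈ klSet W G, ℓ ≠ 3 → padicValInt 3 (nsCount W ℓ) = 0)
    (hunitG : ∀ ℓ ∈ klSet G W, ℓ ≠ 3 → padicValInt 3 (nsCount G ℓ) = 0)
    (htam : ¬ 3 ∣ W.tamagawaProduct) (htamG : ¬ 3 ∣ G.tamagawaProduct) (hordG : GoodOrd G 3)
    (Gd : WeierstrassCurve ℚ) [Gd.IsElliptic] [Gd.IsGloballyMinimal] (htamGd : ¬ 3 ∣ Gd.tamagawaProduct)
    {N N' : ℕ} [NeZero N] [NeZero N'] (D : ModularParametrizationData W N)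
    (D' : ModularParametrizationData G N')
    (K : Type) [Field K] [NumberField K] (hK : IsImaginaryQuadratic K)
    (hH : SatisfiesHeegnerHypothesis N K) (hH' : SatisfiesHeegnerHypothesis N' K)
    (h3K : SatisfiesHeegnerHypothesis 3 K)
    (hKoW : kolyvagin N W K) (hKoG : kolyvagin N' G K) (hGZG : gross_zagier N' G K)
    (hd : NumberField.discr K < -4)
    (hGd : ∃ C : VariableChange ℚ, C • G.quadraticTwist (NumberField.discr K : ℚ) = Gd)
    (H : HeegnerDatum N (NumberField.discr K)) (H' : HeegnerDatum N' (NumberField.discr K))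
    (ι : K →+* ℂ) (𝔭 : HeightOneSpectrum (𝓞 K)) (h𝔭 : ((3 : ℕ) : 𝓞 K) ∈ 𝔭.asIdeal)
    (he : 𝔭.asIdeal.ramificationIdx (𝓞 ℚ) = 1) (hf : 𝔭.asIdeal.inertiaDeg (𝓞 ℚ) = 1)
    (P : (W.baseChange K).toAffine.Point) (P' : (G.baseChange K).toAffine.Point)
    (hP : WeierstrassCurve.Affine.Point.map ι.toRatAlgHom P = heegnerPointComplex D H)
    (hP' : WeierstrassCurve.Affine.Point.map ι.toRatAlgHom P' = heegnerPointComplex D' H')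
    (hPinf : ¬ IsOfFinAddOrder P) (hP'inf : ¬ IsOfFinAddOrder P')
    (hshaW : Nat.card (AddCommGroup.primaryComponent (W.baseChange K).sha 3) = 1)
    (hQW : ∃ Q : (W.baseChange K).toAffine.Point, ¬ IsOfFinAddOrder Q ∧
      X11b.padicLogOrd W 3 (embAt K 3 𝔭 h𝔭 he hf) Q = 0)
    (hcD : padicValInt 3 D.maninConstant = 0) (hc3' : ¬ ((3 : ℤ) ∣ D'.maninConstant)) :
    padicValNat 3 (AddSubgroup.zmultiples P).index = 0 := by
  haveI : Fact (Nat.Prime 3) := ⟨Nat.prime_three⟩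
  -- the three elementary consequences of the new binders
  have h3d : ¬ ((3 : ℤ) ∣ NumberField.discr K) := not_three_dvd_discr_of_split K hK h3K
  have hμ : ¬ 3 ∣ NumberField.Units.torsionOrder K := not_three_dvd_unitsTorsionOrder_of_discr_lt K hK hd
  have hcD' : padicValInt 3 D'.maninConstant = 0 := padicValInt.eq_zero_of_not_dvd hc3'
  obtain ⟨Cd, hCd⟩ := hGd
  have hu : padicValRat 3 (Cd.u : ℚ) = 0 :=
    AdditivePotMult.padicValRat_u_eq_zero_of_twist_minimal_of_split G 3 K hK h3K Cd hCd
  -- class-level discharges (o5-r2 GEN 19, parts OrdTwist): row C16 for the pair, analytic ranks ≤ 1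
  have hE : hasEntireLFunction_rat := hasEntireLFunction_rat_of_exists_isNewformOf hmod
  have hN' : N' = G.conductorNorm ℤ :=
    IsNewformOf.level_eq_conductorNorm_of_exists_isNewformOf hmod D'.isNewformOf
  have hHG : SatisfiesHeegnerHypothesis (G.conductorNorm ℤ) K := hN' ▸ hH'
  have hC16 : RowC16 G 3 := rowC16_three_of_goodOrd_of_isCongruentModThree W G hcong hρ hordG
  have hC16d : RowC16 Gd 3 := rowC16_three_twist_of_heegner G Gd K hK hHG h3d ⟨Cd, hCd⟩ hC16
  obtain ⟨hrG, hrGd⟩ := analyticRank_pair_le_one_of_heegner_nonTorsion hmod G D' K hK hH' hGZG Gd ⟨Cd, hCd⟩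
    ⟨D', H', ι, hP'⟩ hP'inf
  haveI : Finite G.sha := (hGZK G hrG).2
  haveI : Finite Gd.sha := (hGZK Gd hrGd).2
  -- rationality of the two analytic orders: Yan–Zhu on row C16 (Miller's BSD(·,3))
  obtain ⟨q₀, hq₀, -⟩ := missingPPartAt_of_bsdp G 3 (RowC16.bsdp hYZ hW20 hE hGZK hrG hC16)
  obtain ⟨q₁, hq₁, -⟩ := missingPPartAt_of_bsdp Gd 3 (RowC16.bsdp hYZ hW20 hE hGZK hrGd hC16d)
  -- STEP-0 (part 17): Gross–Zagier bookkeeping at the companion pair, exact at `3`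
  have hstep0 := stepZero_three_of_heegner_pair G N' K D' H' ι P' hGZG hKoG hGZK hE hK hH' hP' hP'inf
    hc3' hμ hrG Gd Cd hCd hu hrGd htamG htamGd hq₀ hq₁
  exact o5_index_unit_of_ordinary_companion_facts hA hPT hEP hYZ hW20 hmod hGZK W G hcong hρ hadd ht3 htℓ
    hunitW hunitG htam htamG hordG Gd D D' K hK hH hH' hKoW hKoG hGZG hd h3d ⟨Cd, hCd⟩ H H' ι 𝔭 h𝔭 he hf P
    P' hP hP' hPinf hP'inf hshaW hQW hcD hcD' hq₀ hq₁ hstep0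

/-! ## §2 The END of record of o5-r2 GEN 22: KL3-A cited (part 15), STEP-0 discharged -/

/-- **O5 (t′) END of record (o5-r2 GEN 22): cited, STEP-0 discharged.** Part 15's
`o5_index_unit_of_ordinary_companion_cited` (KL3-A := Kriz–Li 2019 Thm. 1.16 + Rem. 1.17 taken BY NAME
as `hKL`, glued by part 14) with STEP-0 proved (§1). For `W` additive potentially supersingular at `3`
with a `3`-congruent good-ordinary companion `G` and the displayed per-pair data — all of it decidable
per row (congruence, images, local torsion, Euler factors, Tamagawa numbers, Manin constants prime to `3`,
Heegner points non-torsion, `#Ш(W/K)[3^∞] = 1`, the `3`-adic-log unit column `dE = 0`) — ASSUMING ONLY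
published theorems BY NAME (Kriz–Li Thm. 1.16, Poitou–Tate and the local Euler characteristic, Yan–Zhu
Thm. 4.15, Wuthrich Lemma 20, modularity, Gross–Zagier, Kolyvagin, GZK over `ℚ`): `3 ∤ [W(K) : ℤP]` —
whence (parts 1–7 of the chain, o5-r2 GEN 17–19) `BSD(W,3)` for the (t′) curve `W`.
[cite: KrizLi2019, Thm. 1.16, Rem. 1.17] [cite: YanZhu2024MainConjNonCM, Thm. 4.15 (§4.6) = Cor. 1.4]
[cite: GrossZagier1986, Thm. I.6.3 with V.§2 (pp. 310–312)] [cite: MilneADT2006, Ch. I, Thm. 4.10(b), 2.8]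
[cite: Wuthrich2014, Lemma 20 (p. 399)] [cite: Miller2011LMS, Def. 1.1 (arXiv:1010.2431 p. 3)] -/
theorem o5_index_unit_of_ordinary_companion_cited_s0
    (hKL : KrizLi2019.thm116_padicLogHeegner_congruence)
    (hPT : ∀ (K : Type) [Field K] [NumberField K], poitouTate_selmerStructure_duality K)
    (hEP : ∀ (K : Type) [Field K] [NumberField K] (v : HeightOneSpectrum (𝓞 K)),
      localEulerPoincareCharacteristic (v.adicCompletion K))
    (hYZ : YanZhu2026.thm415_padicValRat_bsd_rank_le_one)
    (hW20 : Wuthrich2014.lemma20_surjective_threeAdic_of_semistable)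
    (hmod : exists_isNewformOf) (hGZK : rank_eq_analyticRank_of_analyticRank_le_one)
    (W G : WeierstrassCurve ℚ) [W.IsElliptic] [W.IsGloballyMinimal] [G.IsElliptic] [G.IsGloballyMinimal]
    (hcong : ∀ ℓ : ℕ, ℓ.Prime → ¬ (ℓ ∣ 3 * W.conductorNorm ℤ * G.conductorNorm ℤ) →
      ((W.LFunction ℓ : ℤ) : ZMod 3) = ((G.LFunction ℓ : ℤ) : ZMod 3))
    (hρ : W.HasSurjectiveModNGaloisRep 3) (hadd : Addv W 3) (ht3 : NoLocalThreeTorsionAt W 3)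
    (htℓ : ∀ (ℓ : ℕ) [Fact ℓ.Prime], ℓ ≠ 3 → (ℓ : ℤ) ∣ W.conductorNorm ℤ * G.conductorNorm ℤ →
      NoLocalThreeTorsionAt W ℓ)
    (hunitW : ∀ ℓ ∈ klSet W G, ℓ ≠ 3 → padicValInt 3 (nsCount W ℓ) = 0)
    (hunitG : ∀ ℓ ∈ klSet G W, ℓ ≠ 3 → padicValInt 3 (nsCount G ℓ) = 0)
    (htam : ¬ 3 ∣ W.tamagawaProduct) (htamG : ¬ 3 ∣ G.tamagawaProduct) (hordG : GoodOrd G 3)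
    (Gd : WeierstrassCurve ℚ) [Gd.IsElliptic] [Gd.IsGloballyMinimal] (htamGd : ¬ 3 ∣ Gd.tamagawaProduct)
    {N N' : ℕ} [NeZero N] [NeZero N'] (D : ModularParametrizationData W N)
    (D' : ModularParametrizationData G N')
    (K : Type) [Field K] [NumberField K] (hK : IsImaginaryQuadratic K)
    (hH : SatisfiesHeegnerHypothesis N K) (hH' : SatisfiesHeegnerHypothesis N' K)
    (h3K : SatisfiesHeegnerHypothesis 3 K)
    (hKoW : kolyvagin N W K) (hKoG : kolyvagin N' G K) (hGZG : gross_zagier N' G K)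
    (hd : NumberField.discr K < -4)
    (hGd : ∃ C : VariableChange ℚ, C • G.quadraticTwist (NumberField.discr K : ℚ) = Gd)
    (H : HeegnerDatum N (NumberField.discr K)) (H' : HeegnerDatum N' (NumberField.discr K))
    (ι : K →+* ℂ) (𝔭 : HeightOneSpectrum (𝓞 K)) (h𝔭 : ((3 : ℕ) : 𝓞 K) ∈ 𝔭.asIdeal)
    (he : 𝔭.asIdeal.ramificationIdx (𝓞 ℚ) = 1) (hf : 𝔭.asIdeal.inertiaDeg (𝓞 ℚ) = 1)
    (P : (W.baseChange K).toAffine.Point) (P' : (G.baseChange K).toAffine.Point)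
    (hP : WeierstrassCurve.Affine.Point.map ι.toRatAlgHom P = heegnerPointComplex D H)
    (hP' : WeierstrassCurve.Affine.Point.map ι.toRatAlgHom P' = heegnerPointComplex D' H')
    (hPinf : ¬ IsOfFinAddOrder P) (hP'inf : ¬ IsOfFinAddOrder P')
    (hshaW : Nat.card (AddCommGroup.primaryComponent (W.baseChange K).sha 3) = 1)
    (hQW : ∃ Q : (W.baseChange K).toAffine.Point, ¬ IsOfFinAddOrder Q ∧
      X11b.padicLogOrd W 3 (embAt K 3 𝔭 h𝔭 he hf) Q = 0)
    (hcD : padicValInt 3 D.maninConstant = 0) (hc3' : ¬ ((3 : ℤ) ∣ D'.maninConstant)) :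
    padicValNat 3 (AddSubgroup.zmultiples P).index = 0 :=
  o5_index_unit_of_ordinary_companion_facts_s0
    (krizLiUnitBitTransportThree_of_thm116_of_exists_isNewformOf hKL hmod) hPT hEP hYZ hW20 hmod hGZK W G
    hcong hρ hadd ht3 htℓ hunitW hunitG htam htamG hordG Gd htamGd D D' K hK hH hH' h3K hKoW hKoG hGZG hd
    hGd H H' ι 𝔭 h𝔭 he hf P P' hP hP' hPinf hP'inf hshaW hQW hcD hc3'

/-! ## §3 The same END with `hshaW` discharged by the two `3`-descents over `ℚ` (part 19) -/

/-- **O5 (t′) END of record, certificate form (o5-r2 GEN 22).** §2 with the binder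
`hshaW : #Ш(W/K)[3^∞] = 1` replaced by what the census computes for it: a `ℚ`-model `W_t` of the twist
`W^{(d_K)}`, `3 ∤ #W_t(ℚ)_tors`, and the two sharp `3`-descents `#Sel^(3)(W/ℚ) = 3^{rank W(ℚ)}`,
`#Sel^(3)(W_t/ℚ) = 3^{rank W_t(ℚ)}` (part 19, `hshaW_of_threeDescent_of_surjective`; `3 ∤ #W(ℚ)_tors`
comes from `hρ`). Every displayed per-row input is now a decidable certificate or a published theorem
taken BY NAME; conclusion `3 ∤ [W(K) : ℤP]`. [cite: KrizLi2019, Thm. 1.16, Rem. 1.17]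
[cite: SilvermanAEC2009, Thm. X.4.2(a)] [cite: JetchevSkinnerWan2017, §7.4.1 (arXiv:1512.06894 p. 30)]
[cite: YanZhu2024MainConjNonCM, Thm. 4.15 (§4.6) = Cor. 1.4] [cite: GrossZagier1986, Thm. I.6.3 with V.§2 (pp. 310–312)] -/
theorem o5_index_unit_of_ordinary_companion_cited_s0d
    (hKL : KrizLi2019.thm116_padicLogHeegner_congruence)
    (hPT : ∀ (K : Type) [Field K] [NumberField K], poitouTate_selmerStructure_duality K)
    (hEP : ∀ (K : Type) [Field K] [NumberField K] (v : HeightOneSpectrum (𝓞 K)),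
      localEulerPoincareCharacteristic (v.adicCompletion K))
    (hYZ : YanZhu2026.thm415_padicValRat_bsd_rank_le_one)
    (hW20 : Wuthrich2014.lemma20_surjective_threeAdic_of_semistable)
    (hmod : exists_isNewformOf) (hGZK : rank_eq_analyticRank_of_analyticRank_le_one)
    (W G : WeierstrassCurve ℚ) [W.IsElliptic] [W.IsGloballyMinimal] [G.IsElliptic] [G.IsGloballyMinimal]
    (hcong : ∀ ℓ : ℕ, ℓ.Prime → ¬ (ℓ ∣ 3 * W.conductorNorm ℤ * G.conductorNorm ℤ) →
      ((W.LFunction ℓ : ℤ) : ZMod 3) = ((G.LFunction ℓ : ℤ) : ZMod 3))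
    (hρ : W.HasSurjectiveModNGaloisRep 3) (hadd : Addv W 3) (ht3 : NoLocalThreeTorsionAt W 3)
    (htℓ : ∀ (ℓ : ℕ) [Fact ℓ.Prime], ℓ ≠ 3 → (ℓ : ℤ) ∣ W.conductorNorm ℤ * G.conductorNorm ℤ →
      NoLocalThreeTorsionAt W ℓ)
    (hunitW : ∀ ℓ ∈ klSet W G, ℓ ≠ 3 → padicValInt 3 (nsCount W ℓ) = 0)
    (hunitG : ∀ ℓ ∈ klSet G W, ℓ ≠ 3 → padicValInt 3 (nsCount G ℓ) = 0)
    (htam : ¬ 3 ∣ W.tamagawaProduct) (htamG : ¬ 3 ∣ G.tamagawaProduct) (hordG : GoodOrd G 3)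
    (Gd : WeierstrassCurve ℚ) [Gd.IsElliptic] [Gd.IsGloballyMinimal] (htamGd : ¬ 3 ∣ Gd.tamagawaProduct)
    {N N' : ℕ} [NeZero N] [NeZero N'] (D : ModularParametrizationData W N)
    (D' : ModularParametrizationData G N')
    (K : Type) [Field K] [NumberField K] (hK : IsImaginaryQuadratic K)
    (hH : SatisfiesHeegnerHypothesis N K) (hH' : SatisfiesHeegnerHypothesis N' K)
    (h3K : SatisfiesHeegnerHypothesis 3 K)
    (hKoW : kolyvagin N W K) (hKoG : kolyvagin N' G K) (hGZG : gross_zagier N' G K)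
    (hd : NumberField.discr K < -4)
    (hGd : ∃ C : VariableChange ℚ, C • G.quadraticTwist (NumberField.discr K : ℚ) = Gd)
    (H : HeegnerDatum N (NumberField.discr K)) (H' : HeegnerDatum N' (NumberField.discr K))
    (ι : K →+* ℂ) (𝔭 : HeightOneSpectrum (𝓞 K)) (h𝔭 : ((3 : ℕ) : 𝓞 K) ∈ 𝔭.asIdeal)
    (he : 𝔭.asIdeal.ramificationIdx (𝓞 ℚ) = 1) (hf : 𝔭.asIdeal.inertiaDeg (𝓞 ℚ) = 1)
    (P : (W.baseChange K).toAffine.Point) (P' : (G.baseChange K).toAffine.Point)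
    (hP : WeierstrassCurve.Affine.Point.map ι.toRatAlgHom P = heegnerPointComplex D H)
    (hP' : WeierstrassCurve.Affine.Point.map ι.toRatAlgHom P' = heegnerPointComplex D' H')
    (hPinf : ¬ IsOfFinAddOrder P) (hP'inf : ¬ IsOfFinAddOrder P')
    (Wt : WeierstrassCurve ℚ) [Wt.IsElliptic]
    (hWt : ∃ C : VariableChange ℚ, C • W.quadraticTwist (NumberField.discr K : ℚ) = Wt)
    (htorst : ¬ 3 ∣ Wt.torsionOrder)
    (hSelW : Nat.card (W.selmerGroup (3 : ℤ)) = 3 ^ W.mordellWeilRank)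
    (hSelWt : Nat.card (Wt.selmerGroup (3 : ℤ)) = 3 ^ Wt.mordellWeilRank)
    (hQW : ∃ Q : (W.baseChange K).toAffine.Point, ¬ IsOfFinAddOrder Q ∧
      X11b.padicLogOrd W 3 (embAt K 3 𝔭 h𝔭 he hf) Q = 0)
    (hcD : padicValInt 3 D.maninConstant = 0) (hc3' : ¬ ((3 : ℤ) ∣ D'.maninConstant)) :
    padicValNat 3 (AddSubgroup.zmultiples P).index = 0 :=
  o5_index_unit_of_ordinary_companion_cited_s0 hKL hPT hEP hYZ hW20 hmod hGZK W G hcong hρ hadd ht3 htℓ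
    hunitW hunitG htam htamG hordG Gd htamGd D D' K hK hH hH' h3K hKoW hKoG hGZG hd hGd H H' ι 𝔭 h𝔭 he hf
    P P' hP hP' hPinf hP'inf
    (hshaW_of_threeDescent_of_surjective W K hK hρ Wt hWt htorst hSelW hSelWt) hQW hcD hc3'

end Summit.BirchSwinnertonDyer.Rank1Residual.O5.HeegnerLogTransport

end
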